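import Summits.ResolutionOfSingularities.ResolutionOfSingularities.Theorems.WeightedInvariantELadderTwoCentreChartAt
import Summits.ResolutionOfSingularities.ResolutionOfSingularities.Theorems.WeightedInvariantELadderTwoCentreChartZeros
import Summits.ResolutionOfSingularities.ResolutionOfSingularities.Theorems.WeightedInvariantE2ModelPrimary
import HarnessLib

/-!
# E-ladder rung `e = 2`, centre piece (C-c), scheme hand (o47-c-scheme): MODEL CHARTS ARE MAXIMAL — the (M2) agreement tool at work

[OURS · L1 W4.3 · DOOR `HypersurfaceCentreConstruction` (stmt-ResolutionOfSingularities-19897) · E2 CENTRE piece (C-c), steps (M2)/(G-2) and the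
stalkwise maximality of SPEC (Δ11b) rev 10 `E2CentreHomBody`; written by res-D-pv-048 (gen 11).  Def-free; `--supports` the door item as a
helper.  OURS bookkeeping, NOT a statement of [Hironaka2017]; AI work, weaker than expert review.]

A MODEL CHART of a stage is a chart `W a`, a section `t` and parameters `U : Fin N → Γ(Y, W a)` (`N ≤ 3`, positive weights `w`) with, on `D(t)`:
(S5) `J(𝒪_{Y,y}, f_y)ₘ = 𝒥ₘ(U)·𝒪_{Y,y}` at common zeros `y` of dimension `≤ 3`; (S3) cotangent-independence at common zeros; (Z) common zeros lie
in `M := closure (maxLocus₂)`; (M) points of `M ∩ D(t)` are common zeros (…CentreChartAt, …CentreChartZeros).  Tools: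

* `Stage.hloc_basicOpen` — on `Γ(Y, D(s))`, `D(s) ⊆ D(t)`, the restricted parameters form a REGULAR WEIGHTED CHART in the sense of the (M2)
  file's `hloc` (the local rings are the stalks, regular since `Y` is smooth; (S3));
* `Stage.exists_mem_maxLocus₂_specializes_of_mem_minimalPrimes` — every minimal prime of `(U)` in `Γ(Y, D(t))` specialises INSIDE `D(t)` to a
  point of `maxLocus₂` (the maximum locus is dense in `V(U) ∩ D(t)` by (Z), and the minimal primes are finitely many);
* `Stage.ideal_basicOpen_le_of_forall_stalkIdeal_le` — **STALKWISE ⟹ CHARTWISE MAXIMALITY**: an ideal sheaf `K` with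
  `K_η ≤ J(𝒪_{Y,η}, f_η)ₙ` at every `η ∈ maxLocus₂` has `K(D(t)) ≤ 𝒥ₙ(U)·Γ(Y, D(t))` — by the AGREEMENT TOOL
  `E2Model.le_weightedMonomialIdeal_iff_forall_minimalPrimes` (res-L1-s36-pv-1, …E2ModelPrimary) it suffices to check at the minimal primes
  `ζ` of `(U)`, where `K_ζ` is a further localisation of `K_η`, `ζ ⤳ η ∈ maxLocus₂`, and `J_η = 𝒥ₙ·𝒪_η` by (S5).
-/

noncomputable section

set_option linter.dupNamespace false
set_option backward.isDefEq.respectTransparency false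

open CategoryTheory AlgebraicGeometry TopologicalSpace IsLocalRing
open Literature.AlgebraicGeometry.Resolution
open Summit.ResolutionOfSingularities.ResolutionOfSingularities.Theorems
open Summit.ResolutionOfSingularities.ResolutionOfSingularities.Cruxes.HypersurfaceCentreConstruction.LocalEngine


namespace Summit.ResolutionOfSingularities.ResolutionOfSingularities.Theorems.ELadderOne.Stage

variable {k : Type} [Field k] (S : Stage k) (ι : (R : Type) → [CommRing R] → R → Ordinal.{0})
  (J : (R : Type) → [CommRing R] → R → ℕ → Ideal R)

/-! ## Bookkeeping on affine opens, restrictions and germs -/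

/-- The point of an affine open with a prescribed prime. [folklore] -/
theorem exists_primeIdealOf_eq_affine (W : S.Y.affineOpens) (P : Ideal Γ(S.Y, W)) (hP : P.IsPrime) :
    ∃ (y : S.Y) (hy : y ∈ (W : S.Y.Opens)), (W.2.primeIdealOf ⟨y, hy⟩).asIdeal = P := by
  set q : PrimeSpectrum Γ(S.Y, W) := ⟨P, hP⟩ with hq
  have hy : W.2.fromSpec q ∈ (W : S.Y.Opens) := W.2.range_fromSpec.le ⟨q, rfl⟩
  refine ⟨_, hy, ?_⟩
  have h : W.2.primeIdealOf ⟨W.2.fromSpec q, hy⟩ = q := by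
    apply W.2.fromSpec.isOpenEmbedding.injective
    rw [IsAffineOpen.fromSpec_primeIdealOf]
  rw [h]

/-- On an affine open, `η' ⤳ η` iff the primes satisfy `𝔭(η') ≤ 𝔭(η)`. [folklore] -/
theorem specializes_iff_primeIdealOf_le_affine (W : S.Y.affineOpens) {η η' : S.Y} (hη : η ∈ (W : S.Y.Opens))
    (hη' : η' ∈ (W : S.Y.Opens)) :
    η' ⤳ η ↔ (W.2.primeIdealOf ⟨η', hη'⟩).asIdeal ≤ (W.2.primeIdealOf ⟨η, hη⟩).asIdeal := by
  have key := W.2.fromSpec.isOpenEmbedding.isInducing.specializes_iff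
    (x := W.2.primeIdealOf ⟨η', hη'⟩) (y := W.2.primeIdealOf ⟨η, hη⟩)
  rw [IsAffineOpen.fromSpec_primeIdealOf, IsAffineOpen.fromSpec_primeIdealOf] at key
  rw [key, ← PrimeSpectrum.le_iff_specializes, PrimeSpectrum.asIdeal_le_asIdeal]

/-- Germs through a restriction are germs. [folklore] -/
theorem germ_map_apply {V W : S.Y.Opens} (h : V ≤ W) {y : S.Y} (hy : y ∈ V) (x : Γ(S.Y, W)) :
    (S.Y.presheaf.germ V y hy).hom ((S.Y.presheaf.map (homOfLE h).op).hom x) = (S.Y.presheaf.germ W y (h hy)).hom x := by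
  rw [← CommRingCat.comp_apply, S.Y.presheaf.germ_res (homOfLE h) y hy]

/-- Extending along a restriction and then along the germ is extending along the germ. [folklore] -/
theorem map_germ_map_res {V W : S.Y.Opens} (h : V ≤ W) {y : S.Y} (hy : y ∈ V) (I : Ideal Γ(S.Y, W)) :
    (I.map (S.Y.presheaf.map (homOfLE h).op).hom).map (S.Y.presheaf.germ V y hy).hom = I.map (S.Y.presheaf.germ W y (h hy)).hom := by
  rw [Ideal.map_map]
  congr 1
  ext x
  exact S.germ_map_apply h hy x

/-- The restricted weighted monomial ideal is the weighted monomial ideal of the restricted parameters. [folklore] -/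
theorem map_weightedMonomialIdeal_res {V W : S.Y.Opens} (h : V ≤ W) {N : ℕ} (U : Fin N → Γ(S.Y, W)) (w : Fin N → ℕ) (m : ℕ) :
    (weightedMonomialIdeal U w m).map (S.Y.presheaf.map (homOfLE h).op).hom =
      weightedMonomialIdeal (fun i => (S.Y.presheaf.map (homOfLE h).op).hom (U i)) w m :=
  E2Model.map_weightedMonomialIdeal' U w _ m

/-! ## The regular weighted chart hypothesis `hloc` of the (M2) file on a basic open of a model chart -/

/-- **`hloc` on `Γ(Y, D(s))`, `D(s) ⊆ D(t)`**: at every prime `P ⊇ (U|_{D(s)})` the stalk of `Y` at the point of `P` is a regular local ring,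
a localisation of `Γ(Y, D(s))` at `P`, in whose cotangent space the `U i` are independent ((S3)). [folklore] -/
theorem hloc_basicOpen {a : S.atlas.ι} {N : ℕ} (t : Γ(S.Y, S.atlas.W a)) (U : Fin N → Γ(S.Y, S.atlas.W a))
    (hS3 : ∀ (y : S.Y) (hy : y ∈ S.Y.basicOpen t)
      (hU : ∀ i, (S.Y.presheaf.germ (S.atlas.W a) y (S.Y.basicOpen_le t hy)).hom (U i) ∈ maximalIdeal (S.Y.presheaf.stalk y)),
      LinearIndependent (ResidueField (S.Y.presheaf.stalk y)) (fun i => (maximalIdeal (S.Y.presheaf.stalk y)).toCotangent ⟨_, hU i⟩))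
    (s : Γ(S.Y, S.atlas.W a)) (hst : S.Y.basicOpen s ≤ S.Y.basicOpen t) :
    ∀ (P : Ideal Γ(S.Y, S.Y.affineBasicOpen s)) [P.IsPrime],
      Ideal.span (Set.range fun i => (S.Y.presheaf.map (homOfLE (S.Y.basicOpen_le s)).op).hom (U i)) ≤ P →
      ∃ (R : Type) (_ : CommRing R) (_ : Algebra Γ(S.Y, S.Y.affineBasicOpen s) R) (_ : IsLocalization.AtPrime R P)
        (_ : IsRegularLocalRing R)
        (hmem : ∀ i, algebraMap Γ(S.Y, S.Y.affineBasicOpen s) R ((S.Y.presheaf.map (homOfLE (S.Y.basicOpen_le s)).op).hom (U i)) ∈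
          maximalIdeal R),
        LinearIndependent (ResidueField R) fun i => (maximalIdeal R).toCotangent ⟨_, hmem i⟩ := by
  intro P hP hUP
  obtain ⟨y, hys, hyP⟩ := S.exists_primeIdealOf_eq_affine (S.Y.affineBasicOpen s) P hP
  subst hyP
  have hys' : y ∈ S.Y.basicOpen s := hys
  have hyt : y ∈ S.Y.basicOpen t := hst hys'
  letI := S.Y.presheaf.algebra_section_stalk (⟨y, hys⟩ : (S.Y.affineBasicOpen s : S.Y.Opens))
  haveI : IsLocalization.AtPrime (S.Y.presheaf.stalk y) ((S.Y.affineBasicOpen s).2.primeIdealOf ⟨y, hys⟩).asIdeal :=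
    (S.Y.affineBasicOpen s).2.isLocalization_stalk ⟨y, hys⟩
  haveI : IsRegularLocalRing (S.Y.presheaf.stalk y) := S.isRegularLocalRing_stalk y
  have hgerm : ∀ i, algebraMap Γ(S.Y, S.Y.affineBasicOpen s) (S.Y.presheaf.stalk y)
      ((S.Y.presheaf.map (homOfLE (S.Y.basicOpen_le s)).op).hom (U i)) =
      (S.Y.presheaf.germ (S.atlas.W a) y (S.Y.basicOpen_le t hyt)).hom (U i) := fun i =>
    S.germ_map_apply (S.Y.basicOpen_le s) hys' (U i)
  have hU𝔪 : ∀ i, (S.Y.presheaf.germ (S.atlas.W a) y (S.Y.basicOpen_le t hyt)).hom (U i) ∈ maximalIdeal (S.Y.presheaf.stalk y) := by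
    intro i
    rw [← hgerm i]
    exact (germ_mem_maximalIdeal_iff_mem (S.Y.affineBasicOpen s) hys _).mpr (hUP (Ideal.subset_span ⟨i, rfl⟩))
  have hmem : ∀ i, algebraMap Γ(S.Y, S.Y.affineBasicOpen s) (S.Y.presheaf.stalk y)
      ((S.Y.presheaf.map (homOfLE (S.Y.basicOpen_le s)).op).hom (U i)) ∈ maximalIdeal (S.Y.presheaf.stalk y) := fun i =>
    (hgerm i).symm ▸ hU𝔪 i
  exact ⟨S.Y.presheaf.stalk y, inferInstance, inferInstance, inferInstance, inferInstance, hmem,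
    linearIndependent_toCotangent_congr hU𝔪 hmem (fun i => (hgerm i).symm) (hS3 y hyt hU𝔪)⟩

/-! ## Minimal primes of `(U)` specialise to points of the maximum locus -/

/-- **Every minimal prime of `(U)` in `Γ(Y, D(t))` specialises inside `D(t)` to a point of `maxLocus₂`** (see the module docstring).
[folklore] -/
theorem exists_mem_maxLocus₂_specializes_of_mem_minimalPrimes {a : S.atlas.ι} {N : ℕ} (t : Γ(S.Y, S.atlas.W a))
    (U : Fin N → Γ(S.Y, S.atlas.W a))
    (hZ : ∀ (y : S.Y) (hy : y ∈ S.Y.basicOpen t),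
      (∀ i, (S.Y.presheaf.germ (S.atlas.W a) y (S.Y.basicOpen_le t hy)).hom (U i) ∈ maximalIdeal (S.Y.presheaf.stalk y)) →
      y ∈ closure (S.maxLocus₂ ι))
    (hM : ∀ (y : S.Y) (hy : y ∈ S.Y.basicOpen t), y ∈ closure (S.maxLocus₂ ι) →
      ∀ i, (S.Y.presheaf.germ (S.atlas.W a) y (S.Y.basicOpen_le t hy)).hom (U i) ∈ maximalIdeal (S.Y.presheaf.stalk y))
    {ζ : S.Y} (hζ : ζ ∈ S.Y.basicOpen t)
    (hmin : ((S.Y.affineBasicOpen t).2.primeIdealOf ⟨ζ, hζ⟩).asIdeal ∈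
      (Ideal.span (Set.range fun i => (S.Y.presheaf.map (homOfLE (S.Y.basicOpen_le t)).op).hom (U i))).minimalPrimes) :
    ∃ η ∈ S.maxLocus₂ ι, ∃ (_ : η ∈ S.Y.basicOpen t), ζ ⤳ η := by
  classical
  haveI := S.isNoetherianRing_sections (S.Y.affineBasicOpen t)
  set B := Γ(S.Y, S.Y.affineBasicOpen t) with hB
  set u : Fin N → Γ(S.Y, S.Y.affineBasicOpen t) := fun i => (S.Y.presheaf.map (homOfLE (S.Y.basicOpen_le t)).op).hom (U i) with hu
  set IU : Ideal Γ(S.Y, S.Y.affineBasicOpen t) := Ideal.span (Set.range u) with hIU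
  set 𝔮 := ((S.Y.affineBasicOpen t).2.primeIdealOf ⟨ζ, hζ⟩).asIdeal with h𝔮
  have h𝔮p : 𝔮.IsPrime := ((S.Y.affineBasicOpen t).2.primeIdealOf ⟨ζ, hζ⟩).2
  -- germs through `D(t)` are germs through `W a`
  have hgerm : ∀ (y : S.Y) (hy : y ∈ S.Y.basicOpen t) (i : Fin N),
      (S.Y.presheaf.germ (S.Y.affineBasicOpen t : S.Y.Opens) y hy).hom (u i) =
        (S.Y.presheaf.germ (S.atlas.W a) y (S.Y.basicOpen_le t hy)).hom (U i) := fun y hy i =>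
    S.germ_map_apply (S.Y.basicOpen_le t) hy (U i)
  -- points of `maxLocus₂ ∩ D(t)` contain `(u)`
  have hmax : ∀ (η : S.Y), η ∈ S.maxLocus₂ ι → ∀ (hη : η ∈ S.Y.basicOpen t),
      IU ≤ ((S.Y.affineBasicOpen t).2.primeIdealOf ⟨η, hη⟩).asIdeal := by
    intro η hηm hη
    rw [hIU, Ideal.span_le]
    rintro _ ⟨i, rfl⟩
    have h := hM η hη (subset_closure hηm) i
    rw [← hgerm η hη i] at h
    exact (germ_mem_maximalIdeal_iff_mem (S.Y.affineBasicOpen t) hη (u i)).mp h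
  -- `ζ ∈ M`
  have hζM : ζ ∈ closure (S.maxLocus₂ ι) := by
    refine hZ ζ hζ fun i => ?_
    rw [← hgerm ζ hζ i]
    exact (germ_mem_maximalIdeal_iff_mem (S.Y.affineBasicOpen t) hζ (u i)).mpr (hmin.1.2 (Ideal.subset_span ⟨i, rfl⟩))
  by_contra hnone
  push Not at hnone
  -- the other minimal primes and their intersection `𝔟`
  have hfin := IU.finite_minimalPrimes_of_isNoetherianRing
  let T : Finset (Ideal B) := hfin.toFinset.filter fun 𝔮' => 𝔮' ≠ 𝔮
  -- `𝔟 ≤ 𝔭(η)` for every `η ∈ maxLocus₂ ∩ D(t)`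
  have h𝔟 : ∀ (η : S.Y), η ∈ S.maxLocus₂ ι → ∀ (hη : η ∈ S.Y.basicOpen t),
      T.inf id ≤ ((S.Y.affineBasicOpen t).2.primeIdealOf ⟨η, hη⟩).asIdeal := by
    intro η hηm hη
    obtain ⟨𝔮', h𝔮'min, h𝔮'le⟩ := Ideal.exists_minimalPrimes_le (hmax η hηm hη)
    have hne : 𝔮' ≠ 𝔮 := by
      rintro rfl
      exact hnone η hηm hη ((S.specializes_iff_primeIdealOf_le_affine (S.Y.affineBasicOpen t) hη hζ).mpr h𝔮'le)
    have hT : 𝔮' ∈ T := Finset.mem_filter.mpr ⟨hfin.mem_toFinset.mpr h𝔮'min, hne⟩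
    exact (Finset.inf_le hT).trans h𝔮'le
  -- `𝔟 ≤ 𝔮`: an `f ∈ 𝔟` off `𝔮` gives `ζ ∈ D(f)`, which meets `maxLocus₂` — where `f` vanishes
  have h𝔟𝔮 : T.inf id ≤ 𝔮 := by
    intro f hf
    by_contra hf𝔮
    have hζf : ζ ∈ S.Y.basicOpen f := (mem_basicOpen_iff_not_mem (S.Y.affineBasicOpen t) hζ f).mpr hf𝔮
    obtain ⟨η, hηf, hηm⟩ := mem_closure_iff.mp hζM _ (S.Y.basicOpen f).2 hζf
    have hηt : η ∈ S.Y.basicOpen t := S.Y.basicOpen_le f hηf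
    exact (mem_basicOpen_iff_not_mem (S.Y.affineBasicOpen t) hηt f).mp hηf (h𝔟 η hηm hηt hf)
  -- so another minimal prime lies in `𝔮`: contradiction with minimality
  obtain ⟨𝔮', h𝔮'T, h𝔮'le⟩ := h𝔮p.inf_le'.mp h𝔟𝔮
  obtain ⟨h𝔮'min, hne⟩ := Finset.mem_filter.mp h𝔮'T
  have h𝔮'min' := hfin.mem_toFinset.mp h𝔮'min
  exact hne (le_antisymm h𝔮'le (hmin.2 ⟨h𝔮'min'.1.1, h𝔮'min'.1.2⟩ h𝔮'le))

/-! ## Stalkwise maximality on the maximum locus ⟹ chartwise maximality -/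

/-- **STALKWISE ⟹ CHARTWISE MAXIMALITY** (see the module docstring). [folklore] -/
theorem ideal_basicOpen_le_of_forall_stalkIdeal_le {a : S.atlas.ι} {N : ℕ} (t : Γ(S.Y, S.atlas.W a))
    (U : Fin N → Γ(S.Y, S.atlas.W a)) (w : Fin N → ℕ) (hw : ∀ i, 0 < w i)
    (hS5 : ∀ (y : S.Y) (hy : y ∈ S.Y.basicOpen t), ringKrullDim (S.Y.presheaf.stalk y) ≤ ((3 : ℕ) : WithBot ℕ∞) →
      (∀ i, (S.Y.presheaf.germ (S.atlas.W a) y (S.Y.basicOpen_le t hy)).hom (U i) ∈ maximalIdeal (S.Y.presheaf.stalk y)) →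
      ∀ m : ℕ, J (S.Y.presheaf.stalk y) (localGenerator S.i.ker y) m =
        (weightedMonomialIdeal U w m).map (S.Y.presheaf.germ (S.atlas.W a) y (S.Y.basicOpen_le t hy)).hom)
    (hS3 : ∀ (y : S.Y) (hy : y ∈ S.Y.basicOpen t)
      (hU : ∀ i, (S.Y.presheaf.germ (S.atlas.W a) y (S.Y.basicOpen_le t hy)).hom (U i) ∈ maximalIdeal (S.Y.presheaf.stalk y)),
      LinearIndependent (ResidueField (S.Y.presheaf.stalk y)) (fun i => (maximalIdeal (S.Y.presheaf.stalk y)).toCotangent ⟨_, hU i⟩))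
    (hZ : ∀ (y : S.Y) (hy : y ∈ S.Y.basicOpen t),
      (∀ i, (S.Y.presheaf.germ (S.atlas.W a) y (S.Y.basicOpen_le t hy)).hom (U i) ∈ maximalIdeal (S.Y.presheaf.stalk y)) →
      y ∈ closure (S.maxLocus₂ ι))
    (hM : ∀ (y : S.Y) (hy : y ∈ S.Y.basicOpen t), y ∈ closure (S.maxLocus₂ ι) →
      ∀ i, (S.Y.presheaf.germ (S.atlas.W a) y (S.Y.basicOpen_le t hy)).hom (U i) ∈ maximalIdeal (S.Y.presheaf.stalk y))
    {n : ℕ} (K : S.Y.IdealSheafData)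
    (hK : ∀ η ∈ S.maxLocus₂ ι, stalkIdeal K η ≤ J (S.Y.presheaf.stalk η) (localGenerator S.i.ker η) n) :
    K.ideal (S.Y.affineBasicOpen t) ≤
      (weightedMonomialIdeal U w n).map (S.Y.presheaf.map (homOfLE (S.Y.basicOpen_le t)).op).hom := by
  classical
  haveI := S.isNoetherianRing_sections (S.Y.affineBasicOpen t)
  rw [S.map_weightedMonomialIdeal_res (S.Y.basicOpen_le t) U w n]
  have hloc := S.hloc_basicOpen t U hS3 t le_rfl
  refine (E2Model.le_weightedMonomialIdeal_iff_forall_minimalPrimes _ w hw hloc).mpr ?_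
  intro 𝔮 h𝔮min
  haveI h𝔮p : 𝔮.IsPrime := h𝔮min.1.1
  obtain ⟨ζ, hζ, hζ𝔮⟩ := S.exists_primeIdealOf_eq_affine (S.Y.affineBasicOpen t) 𝔮 h𝔮p
  subst hζ𝔮
  letI := S.Y.presheaf.algebra_section_stalk (⟨ζ, hζ⟩ : (S.Y.affineBasicOpen t : S.Y.Opens))
  haveI : IsLocalization.AtPrime (S.Y.presheaf.stalk ζ) ((S.Y.affineBasicOpen t).2.primeIdealOf ⟨ζ, hζ⟩).asIdeal :=
    (S.Y.affineBasicOpen t).2.isLocalization_stalk ⟨ζ, hζ⟩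
  refine (E2Model.forall_exists_mul_mem_iff_map_le _ (S.Y.presheaf.stalk ζ) _ _).mpr ?_
  -- a point `η ∈ maxLocus₂ ∩ D(t)` with `ζ ⤳ η`; there `K_η ≤ J_η = 𝒥ₙ·𝒪_η` ((S5))
  obtain ⟨η, hηm, hηt, hζη⟩ := S.exists_mem_maxLocus₂_specializes_of_mem_minimalPrimes ι t U hZ hM hζ h𝔮min
  have hUη := hM η hηt (subset_closure hηm)
  have hJη := hS5 η hηt hηm.1.2.2 hUη n
  have hKη : (K.ideal (S.Y.affineBasicOpen t)).map (S.Y.presheaf.germ (S.Y.affineBasicOpen t : S.Y.Opens) η hηt).hom ≤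
      (weightedMonomialIdeal U w n).map (S.Y.presheaf.germ (S.atlas.W a) η (S.Y.basicOpen_le t hηt)).hom := by
    rw [← stalkIdeal_eq_map_germ K (S.Y.affineBasicOpen t) hηt, ← hJη]
    exact hK η hηm
  -- push along the specialisation map `𝒪_{Y,η} → 𝒪_{Y,ζ}`
  have hc1 := congrArg CommRingCat.Hom.hom
    (S.Y.presheaf.germ_stalkSpecializes (U := (S.Y.affineBasicOpen t : S.Y.Opens)) (hy := hηt) hζη)
  have hc2 := congrArg CommRingCat.Hom.hom
    (S.Y.presheaf.germ_stalkSpecializes (U := (S.atlas.W a : S.Y.Opens)) (hy := S.Y.basicOpen_le t hηt) hζη)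
  rw [CommRingCat.hom_comp] at hc1 hc2
  have h1 := Ideal.map_mono (f := (S.Y.presheaf.stalkSpecializes hζη).hom) hKη
  rw [Ideal.map_map, Ideal.map_map, hc1, hc2] at h1
  -- read the goal through the germ maps
  show (K.ideal (S.Y.affineBasicOpen t)).map (S.Y.presheaf.germ (S.Y.affineBasicOpen t : S.Y.Opens) ζ hζ).hom ≤
    (weightedMonomialIdeal (fun i => (S.Y.presheaf.map (homOfLE (S.Y.basicOpen_le t)).op).hom (U i)) w n).map
      (S.Y.presheaf.germ (S.Y.affineBasicOpen t : S.Y.Opens) ζ hζ).hom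
  rw [← S.map_weightedMonomialIdeal_res (S.Y.basicOpen_le t) U w n,
    S.map_germ_map_res (V := (S.Y.affineBasicOpen t : S.Y.Opens)) (S.Y.basicOpen_le t) hζ]
  exact h1

end Summit.ResolutionOfSingularities.ResolutionOfSingularities.Theorems.ELadderOne.Stage

end
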